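import Summits.PneNP.PneNP.Theorems.ConvexRankGatesCliqueExtLowerBoundSandwichEffectiveWidth

/-!
# Short CNF majorants sandwich the gate — the dual engine
(stub `sandwichable_of_shortCNF` of the line `width-threshold-certificate-sparsity`,
crux `ConvexRankGates.CliqueExtLowerBound`, stmt-PneNP-10682)

The landed engine `SandwichEffectiveWidth.sandwichable_of_shortDNF` shows that a short-DNF
MINORANT covering the accepted positives sandwiches a gate. This file is its mirror image on the
negative side, in the unfolded vocabulary of the r7 leaves (positives `P` = clique vectors of the
`⌈m^{1/4}⌉₊`-sets, negatives `N` = complements of the `#E/⌊m^{1/8}⌋₊`-subsets of the edge slots,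
error `1/(8 m^{c+1})`):

* `sandwichable_of_shortCNF`: for every `c` and every constant clause width `w` there are
  `r₀ = C(4(c+3), 2) + 1`, `s₀ = 16 (c+4)` such that for `r ≥ r₀`, `s ≥ s₀` and all large `m`,
  ANY Boolean function `g` of the edge slots admits a legal `(r, s)`-local sandwich `dnf ≤ cnf`
  as soon as some CNF `B₀` with clauses of `≤ w` edges (i) holds on every positive accepted by `g`
  and (ii) holds on at most `#N/(16 m^{c+1})` of the negatives rejected by `g`.

Proof (Jukna 2012, Lemma 9.15, read backwards): switch `B₀` DOWN to an `(r-1)`-DNF `A`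
(`monotoneSwitching_cnf`; at most `w^r` exceptional exact `r`-monomials, each satisfied by at most
`(k/m)^{4(c+3)} #P` positives, `card_filter_pos_mul_pow_le` / `pos_numerics`), then `A` UP to an
`(s-1)`-CNF `B` (`monotoneSwitching_dnf`; at most `(r-1)^s` exceptional exact `s`-clauses, each
falsified by at most `⌊m^{1/8}⌋₊^{-s} #N` negatives, `card_filter_neg_mul_pow_le` /
`eventually_neg_numerics`); output `(A, B)`. A positive accepted by `g` but not by `A` satisfies
`B₀` (hypothesis (i)), hence an exceptional monomial; a negative accepted by `B` but rejected by `g`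
either satisfies all exceptional clauses — then it satisfies `A`, hence `B₀`, and is one of the
certified rejections of hypothesis (ii) — or falsifies one of them.

References: S. Jukna, *Boolean Function Complexity* (2012), Lemma 9.15 [Jukna2012].
-/
set_option linter.dupNamespace false

open Literature.Computability.Complexity Filter Finset

namespace Summit.PneNP.PneNP.Theorems.CliqueExtLowerBound.WidthThreshold.ShortCnf

open Summit.PneNP.PneNP.Theorems.CliqueExtLowerBound.WidthThreshold.NarrowAlgebraicHelpers
open Summit.PneNP.PneNP.Theorems.CliqueExtLowerBound.WidthThreshold.NarrowAlgebraic
  (card_mul_le_of_subset_biUnion)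

open Classical in
/-- **A short CNF majorant sandwiches the gate** (the dual engine of
`SandwichEffectiveWidth.sandwichable_of_shortDNF`). For every `c` and every clause width `w` there
are `r₀ = C(4(c+3), 2) + 1`, `s₀ = 16 (c+4)` such that for `r ≥ r₀`, `s ≥ s₀` and all large `m`:
ANY Boolean function `g` of the edge slots of `K_m` admits the legal local sandwich of the r7
leaves (an `(r-1)`-DNF below an `(s-1)`-CNF, positive error `≤ #P/(8 m^{c+1})` against the DNF,
negative error `≤ #N/(8 m^{c+1})` against the CNF) as soon as some CNF `B₀` with clauses of `≤ w`
edges (i) holds on every positive accepted by `g` and (ii) holds on at most `#N/(16 m^{c+1})` of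
the negatives rejected by `g`. Proof: switch `B₀` down to an `(r-1)`-DNF `A` (`≤ w^r` exceptional
exact `r`-monomials, each on `≤ Q^{-4(c+3)} #P` positives, `Q = m/k`), then `A` up to an
`(s-1)`-CNF `B` (`≤ (r-1)^s` exceptional exact `s`-clauses, each failing on `≤ ⌊m^{1/8}⌋₊^{-s} #N`
negatives); output `(A, B)`. [cite: Jukna2012, Lemma 9.15] -/
theorem sandwichable_of_shortCNF : ∀ c w : ℕ, ∃ r₀ s₀ : ℕ, 2 ≤ r₀ ∧ 2 ≤ s₀ ∧ ∀ r s : ℕ, r₀ ≤ r → s₀ ≤ s →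
    ∀ᶠ m : ℕ in atTop, ∀ (g : (((⊤ : SimpleGraph (Fin m)).edgeSet) → Bool) → Bool)
      (B₀ : Finset (Finset ((⊤ : SimpleGraph (Fin m)).edgeSet))),
      (∀ S ∈ B₀, #S ≤ w) →
      (∀ x ∈ posGraphs m ⌈(m : ℝ) ^ (1 / 4 : ℝ)⌉₊, g x = true → EvalCNF B₀ x) →
      #((((powersetCard (Fintype.card ((⊤ : SimpleGraph (Fin m)).edgeSet) / ⌊(m : ℝ) ^ (1 / 8 : ℝ)⌋₊)
          (univ : Finset ((⊤ : SimpleGraph (Fin m)).edgeSet))).image (fun M => fun e => decide (e ∉ M)))).filter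
          (fun x => EvalCNF B₀ x ∧ g x = false)) * (16 * m ^ (c + 1)) ≤
        #(((powersetCard (Fintype.card ((⊤ : SimpleGraph (Fin m)).edgeSet) / ⌊(m : ℝ) ^ (1 / 8 : ℝ)⌋₊)
          (univ : Finset ((⊤ : SimpleGraph (Fin m)).edgeSet))).image (fun M => fun e => decide (e ∉ M)))) →
      ∃ dnf cnf : Finset (Finset ((⊤ : SimpleGraph (Fin m)).edgeSet)),
        (∀ R ∈ dnf, #R ≤ r - 1) ∧ (∀ S ∈ cnf, #S ≤ s - 1) ∧
        (∀ x, EvalDNF dnf x → EvalCNF cnf x) ∧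
        (#((posGraphs m ⌈(m : ℝ) ^ (1 / 4 : ℝ)⌉₊).filter
            (fun x => g x = true ∧ ¬ EvalDNF dnf x)) : ℝ)
          ≤ (1 / (8 * (m : ℝ) ^ (c + 1))) * #(posGraphs m ⌈(m : ℝ) ^ (1 / 4 : ℝ)⌉₊) ∧
        (#((((powersetCard (Fintype.card ((⊤ : SimpleGraph (Fin m)).edgeSet) / ⌊(m : ℝ) ^ (1 / 8 : ℝ)⌋₊)
        (univ : Finset ((⊤ : SimpleGraph (Fin m)).edgeSet))).image (fun M => fun e => decide (e ∉ M)))).filter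
            (fun x => EvalCNF cnf x ∧ g x = false)) : ℝ)
          ≤ (1 / (8 * (m : ℝ) ^ (c + 1))) *
            #(((powersetCard (Fintype.card ((⊤ : SimpleGraph (Fin m)).edgeSet) / ⌊(m : ℝ) ^ (1 / 8 : ℝ)⌋₊)
        (univ : Finset ((⊤ : SimpleGraph (Fin m)).edgeSet))).image (fun M => fun e => decide (e ∉ M)))) := by
  intro c w
  have hv2 : 1 ≤ (4 * (c + 3)).choose 2 := Nat.choose_pos (by omega)
  refine ⟨(4 * (c + 3)).choose 2 + 1, 16 * (c + 4), by omega, by omega, ?_⟩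
  intro r s hr hs
  have hρ : 1 ≤ r - 1 := by omega
  filter_upwards [eventually_neg_numerics (c + 1) (r - 1) s (by omega) hρ, eventually_ge_atTop 17,
    eventually_ge_atTop (8 * w ^ r)] with m hneg hm17 hm8
  intro g B₀ hB₀w hB₀P hB₀N
  -- the parameters `T = ⌊m^{1/16}⌋₊`, `D = ⌊m^{1/8}⌋₊`, `k = ⌈m^{1/4}⌉₊` and their sandwiches
  have hm1 : 1 ≤ m := by omega
  have hmT : m < (⌊(m : ℝ) ^ (1 / 16 : ℝ)⌋₊ + 1) ^ 16 :=
    lt_floor_rpow_add_one_pow m 16 (by norm_num)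
  have hmD : m < (⌊(m : ℝ) ^ (1 / 8 : ℝ)⌋₊ + 1) ^ 8 := lt_floor_rpow_add_one_pow m 8 (by norm_num)
  have hkm : m ≤ ⌈(m : ℝ) ^ (1 / 4 : ℝ)⌉₊ ^ 4 := le_ceil_rpow_pow m 4 (by norm_num)
  have hk1m : (⌈(m : ℝ) ^ (1 / 4 : ℝ)⌉₊ - 1) ^ 4 < m := ceil_rpow_sub_one_pow_lt hm1 4 (by norm_num)
  have hm8' : 8 * (w + 1 - 1) ^ r ≤ m := by rwa [Nat.add_sub_cancel]
  obtain ⟨hk2, hQ1, hpos⟩ := pos_numerics (c := c) hm17 hm8' hkm hk1m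
  rw [Nat.add_sub_cancel] at hpos
  set T := ⌊(m : ℝ) ^ (1 / 16 : ℝ)⌋₊
  set Dd := ⌊(m : ℝ) ^ (1 / 8 : ℝ)⌋₊
  set k := ⌈(m : ℝ) ^ (1 / 4 : ℝ)⌉₊
  have hT1 : 1 ≤ T := Nat.pos_of_ne_zero fun h0 => by rw [h0] at hmT; norm_num at hmT; omega
  have hD1 : 1 ≤ Dd := Nat.pos_of_ne_zero fun h0 => by rw [h0] at hmD; norm_num at hmD; omega
  -- two switchings of the short CNF `B₀`: down to `A`, then `A` up to `B`
  obtain ⟨A, Df, hAw, hDfw, hDfcard, hAB₀, hB₀A⟩ :=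
    monotoneSwitching_cnf B₀ (w + 1) r (fun S hS => by rw [Nat.add_sub_cancel]; exact hB₀w S hS)
  rw [Nat.add_sub_cancel] at hDfcard
  obtain ⟨B, Cf, hBw, hCfw, hCfcard, hAB, hBCf⟩ := monotoneSwitching_dnf A r s hAw
  refine ⟨A, B, hAw, hBw, hAB, ?_, ?_⟩
  · -- POSITIVE SIDE: an accepted positive missed by `A` satisfies `B₀`, hence a monomial of `Df`
    apply cast_le_eps_mul hm1
    set dfp := Df.biUnion fun R => (posGraphs m k).filter fun x => SatTerm R x
    have hsub : (posGraphs m k).filter (fun x => g x = true ∧ ¬ EvalDNF A x) ⊆ dfp := by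
      intro x hx
      rw [Finset.mem_filter] at hx
      obtain ⟨hxP, hgx, hAx⟩ := hx
      rcases hB₀A x (hB₀P x hxP hgx) with h | ⟨R, hR, hRx⟩
      · exact absurd h hAx
      · exact Finset.mem_biUnion.2 ⟨R, hR, Finset.mem_filter.2 ⟨hxP, hRx⟩⟩
    have hstep := card_mul_le_of_subset_biUnion dfp Df _ (subset_refl _) fun R hR =>
      card_filter_pos_mul_pow_le hk2 hQ1 (Nat.mul_div_le m k) R
        (show (4 * (c + 3)).choose 2 < #R by rw [hDfw R hR]; omega) (fun x => SatTerm R x)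
        (fun x hx => hx)
    refine Nat.le_of_mul_le_mul_right ?_ (Nat.pow_pos (n := 4 * (c + 3)) hQ1)
    calc _ ≤ #dfp * (8 * m ^ (c + 1)) * (m / k) ^ (4 * (c + 3)) :=
          Nat.mul_le_mul_right _ (Nat.mul_le_mul_right _ (Finset.card_le_card hsub))
      _ = 8 * m ^ (c + 1) * (#dfp * (m / k) ^ (4 * (c + 3))) := by ring
      _ ≤ 8 * m ^ (c + 1) * (w ^ r * #(posGraphs m k)) :=
          Nat.mul_le_mul_left _ (hstep.trans (Nat.mul_le_mul_right _ hDfcard))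
      _ = 8 * m ^ (c + 1) * w ^ r * #(posGraphs m k) := (Nat.mul_assoc _ _ _).symm
      _ ≤ (m / k) ^ (4 * (c + 3)) * #(posGraphs m k) := Nat.mul_le_mul_right _ hpos
      _ = #(posGraphs m k) * (m / k) ^ (4 * (c + 3)) := Nat.mul_comm _ _
  · -- NEGATIVE SIDE: a negative accepted by `B` but rejected by `g` is a certified rejection
    -- (hypothesis (ii)) unless it falsifies one of the exact `s`-clauses of `Cf`
    apply cast_le_eps_mul hm1
    set N := ((powersetCard (Fintype.card ((⊤ : SimpleGraph (Fin m)).edgeSet) / Dd)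
        (univ : Finset ((⊤ : SimpleGraph (Fin m)).edgeSet))).image
          (fun M => fun e => decide (e ∉ M)))
    set cert := N.filter (fun x => EvalCNF B₀ x ∧ g x = false)
    set cfn := Cf.biUnion fun S => N.filter fun x => ¬ SatClause S x
    have hsub : N.filter (fun x => EvalCNF B x ∧ g x = false) ⊆ cert ∪ cfn := by
      intro x hx
      rw [Finset.mem_filter] at hx
      obtain ⟨hxN, hBx, hgx⟩ := hx
      by_cases hCfx : EvalCNF Cf x
      · exact Finset.mem_union_left _
          (Finset.mem_filter.2 ⟨hxN, hAB₀ x (hBCf x hBx hCfx), hgx⟩)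
      · obtain ⟨S, hS, hSx⟩ : ∃ S ∈ Cf, ¬ SatClause S x := by simpa [EvalCNF] using hCfx
        exact Finset.mem_union_right _
          (Finset.mem_biUnion.2 ⟨S, hS, Finset.mem_filter.2 ⟨hxN, hSx⟩⟩)
    have hstep := card_mul_le_of_subset_biUnion cfn Cf _ (subset_refl _) (W := Dd ^ s)
      fun S hS => by
        rw [← hCfw S hS]
        exact card_filter_neg_mul_pow_le hD1 (Nat.div_mul_le_self _ _)
          (fun M => fun e => decide (e ∉ M)) (fun M e => by simp) S _ (fun x hx => hx)
    have h16 : 16 * m ^ (c + 1) * (r - 1) ^ s ≤ Dd ^ s := by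
      refine le_trans ?_ hneg
      have h1 : 1 ≤ T * (Nat.log 2 T + 1) := Nat.mul_pos hT1 (Nat.succ_pos _)
      calc 16 * m ^ (c + 1) * (r - 1) ^ s ≤ 8 * m * m ^ (c + 1) * (1 * (r - 1)) ^ s := by
            rw [one_mul]
            have : 16 ≤ 8 * m := by omega
            gcongr
        _ ≤ 8 * m ^ (c + 1 + 1) * (T * (Nat.log 2 T + 1) * (r - 1)) ^ s := by
            rw [show 8 * m * m ^ (c + 1) = 8 * m ^ (c + 1 + 1) by ring]
            gcongr
    have hcfn : #cfn * (16 * m ^ (c + 1)) ≤ #N := by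
      refine Nat.le_of_mul_le_mul_right ?_ (Nat.pow_pos (n := s) hD1)
      calc #cfn * (16 * m ^ (c + 1)) * Dd ^ s = 16 * m ^ (c + 1) * (#cfn * Dd ^ s) := by ring
        _ ≤ 16 * m ^ (c + 1) * ((r - 1) ^ s * #N) :=
            Nat.mul_le_mul_left _ (hstep.trans (Nat.mul_le_mul_right _ hCfcard))
        _ = 16 * m ^ (c + 1) * (r - 1) ^ s * #N := (Nat.mul_assoc _ _ _).symm
        _ ≤ Dd ^ s * #N := Nat.mul_le_mul_right _ h16
        _ = #N * Dd ^ s := Nat.mul_comm _ _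
    calc #(N.filter (fun x => EvalCNF B x ∧ g x = false)) * (8 * m ^ (c + 1))
        ≤ #(cert ∪ cfn) * (8 * m ^ (c + 1)) := Nat.mul_le_mul_right _ (Finset.card_le_card hsub)
      _ ≤ (#cert + #cfn) * (8 * m ^ (c + 1)) := Nat.mul_le_mul_right _ (Finset.card_union_le _ _)
      _ ≤ #N := by
          have h1 : #cert * (16 * m ^ (c + 1)) ≤ #N := hB₀N
          have e1 : #cert * (16 * m ^ (c + 1)) + #cfn * (16 * m ^ (c + 1)) =
              2 * ((#cert + #cfn) * (8 * m ^ (c + 1))) := by ring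
          omega

end Summit.PneNP.PneNP.Theorems.CliqueExtLowerBound.WidthThreshold.ShortCnf
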